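import Mathlib
import HarnessLib
import HarnessLib.Audit
import Summits.HodgeConjecture.Statement
import Summits.HodgeConjecture.HodgeConjecture.Theorems.F0FloorSockets
import HarnessLib.Audit.Status.Attr

/-!
Route: HCCMUnconditional

# Route HCCMUnconditional — HC_CM unconditional (HODGECM-MATHLIB rung 0)

Discharge the 7 printed-citation hypotheses of
`hc_cm_of_printed_citations_muKey_ident_lemD3_delRecConjOmegaT`
(lean/Summits/HodgeConjecture/CorCM/D2Bridge/ClosedPrintedMuKeyIdentLemD3DelRecConjOmegaT.lean:103–186)
so HC_CM holds with no hypotheses beyond Mathlib. It suffices to show the seven named Props of the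
certificate module `Summits/HodgeConjecture/CorCM/D2Bridge/PrintedCitationHypothesesT.lean`
(p588166): HypDel, Hyp21, HypLiu418, Hyp413, Hyp411, HypD3, HypD1pp — byte-copies of the headline's
binders, the last five closed over `hDel` (their types depend on it).
Lean:
Summit.HodgeConjecture.CorCM.D2Bridge.MuKeyIdentLemD3DelRecConjOmegaEndT.PrintedCitationHypotheses.HypDel
∧
Summit.HodgeConjecture.CorCM.D2Bridge.MuKeyIdentLemD3DelRecConjOmegaEndT.PrintedCitationHypotheses.Hyp21
∧
Summit.HodgeConjecture.CorCM.D2Bridge.MuKeyIdentLemD3DelRecConjOmegaEndT.PrintedCitationHypotheses.HypLiu418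
∧
Summit.HodgeConjecture.CorCM.D2Bridge.MuKeyIdentLemD3DelRecConjOmegaEndT.PrintedCitationHypotheses.Hyp413
∧
Summit.HodgeConjecture.CorCM.D2Bridge.MuKeyIdentLemD3DelRecConjOmegaEndT.PrintedCitationHypotheses.Hyp411
∧
Summit.HodgeConjecture.CorCM.D2Bridge.MuKeyIdentLemD3DelRecConjOmegaEndT.PrintedCitationHypotheses.HypD3
∧
Summit.HodgeConjecture.CorCM.D2Bridge.MuKeyIdentLemD3DelRecConjOmegaEndT.PrintedCitationHypotheses.HypD1pp

## Assembly
`closes hDel h21 hLiu418 h413 h411 hD3 hD1pp : CMAbelianHodge := hc_cm_of_hyps hDel h21 hLiu418 h413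
h411 hD3 hD1pp` — the certificate theorem applies the headline at `(hLiu418 hDel) … (hD1pp hDel)`;
`HC_CM` is by definition `RankFourFaces.CMAbelianHodge` (leaf «HC_CM», class rung). Release-track
D-0151; bookkeeping wording by gate5, planners refine via route edit.

CLOSES_TARGET: closes rung HODGECM-MATHLIB-0 of HodgeConjecture: Summit.HodgeConjecture.HodgeConjecture.Theses.RankFourFaces.CMAbelianHodge (D-0061; not the summit Statement) — the deciding theorem of this route concludes that registered leaf instead of the Statement decl `HodgeConjecture` (class rung: servable and labelled, never counted as concluding the summit Statement).

Rationale: WHY THIS LINE. The tree holds a kernel-checked headline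
`hc_cm_of_printed_citations_muKey_ident_lemD3_delRecConjOmegaT : hDel → h21 → hLiu418 → h411 → h413
→ hD3 → hD1'' → HC_CM` whose seven hypotheses are statements of printed results (Deligne 1979;
Shimura 1998 Thm 21.4; Liu 2021 Thm 4.18, Prop 4.13, Def 4.11, Lem D.1(3), Lem D.1(1)) typed "as
printed". HC_CM therefore holds over Mathlib alone exactly when the seven are proved in Lean. This
route makes each hypothesis a separately staffed, separately refutable crux (HODGECM-MATHLIB fans
A/B, release-track D-0151). Mechanism: formalisation of the cited proofs against the tree's
interface; no new mathematics is claimed.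

RANKED CRUXES. #2 HLiu418 (A-III; H-R3 orientation check) — Liu Thm 4.18 as printed, transported
from the conjugate space. #3 H413 — Liu Prop 4.13. #4 H21 — Shimura Thm 21.4 (Casselman). #5 HDel —
Deligne 2.2.5/2.7.21 canonical model. #6 H411 — Liu Def 4.11 sentence. #7 HD3 — Liu Lem D.1(3). #8
HD1pp — Liu Lem D.1(1). Statements are the names `PrintedCitationHypotheses.Hyp*` (verbatim binder
types; five closed over hDel because the printed statement is relative to the canonical-model
datum).

KILL CRITERIA. A Lean refutation of any crux (¬Hyp*) closes the route as refuted at that crux and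
files the mismatch between the typed "as printed" statement and the source as a negative; if the
mismatch is a typing artefact the repair is a restate of that crux to the weaker form the headline
actually consumes (specialised child item), not a pivot. A proof of CMAbelianHodge by another route
moots this one.

NOT DECOMPOSED YET. No crux is split at open. Foreseen layer 2 (planners hodgecm-mathlib-A-plan1/2,
B-plan1/2): HLiu418 into the local theta-lifting inputs of Liu §4; HDel into (abelian-type
reduction, reciprocity at special points); the Liu App. D lemmas per place type (split / inert /
ramified). Interface statements toward Mathlib live under Literature/<Topic>/.

CHEAPEST FALSIFIER. For each crux run `exact?`/`decide`-level probes and the C→leaf battery (does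
the crux alone imply CMAbelianHodge? it must not); for H411 try `unfold Def411AsPrinted; rfl`-style
discharge — if it closes by unfolding the crux was definitional and costs nothing; for HD3/HD1pp
instantiate at a ramified place of the smallest admissible F (degree 6) and compare with Liu's
hypotheses in print.

NUMBERS. Headline: 7 hypotheses, 0 sorry, file
lean/Summits/HodgeConjecture/CorCM/D2Bridge/ClosedPrintedMuKeyIdentLemD3DelRecConjOmegaT.lean (186
lines). Certificate module p588166: 139 lines, farm check rc 0 / 0 errors / 0 sorry / 71 s. Binder
sizes (chars): hLiu418 11 072, hD1'' 3 595, hD3 3 115, h413 1 567, h411 1 095, hDel 97, h21 29.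

SOURCES. Liu2021; Deligne1979ShimuraVarieties; Milne2005ShimuraVarieties; Shimura1998.

Novelty: Searches (2026-08-28, gate5, bookkeeping route): lean search --decl 'hc_cm_of_printed_citations'
(tree: the headline and its END variants only); ledger route list --problem HodgeConjecture
(RankFourFaces, PadicSemiregularLift, SevenfoldWeilCensus, … — none stages the seven printed
citations as items); ledger negatives --problem HodgeConjecture (no entry on Liu 2021 / Deligne 1979
inputs).
Nearest prior art found: Liu2021 (the printed source of five cruxes); Deligne1979ShimuraVarieties
(canonical models); Shimura1998 (Thm 21.4); in-tree route-HodgeConjecture-RankFourFaces (item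
CMAbelianHodge = HC_CM, the leaf this route closes).
Delta: no new mechanism — the line converts the headline's seven printed-citation hypotheses into
ledger cruxes so that HC_CM's remaining debt is exactly the formalisation of those seven results
over Mathlib. Claimed grade: variant  [refs: Liu2021, Shimura1998]

Barriers (technique_class: formalisation, theta-lifting, shimura-varieties): - technique_class: formalisation, theta-lifting, shimura-varieties
- Literature.Barriers.HodgeConjecture.Charles2009_conjugateVarieties_cohomologyAlgebrasNotIso:
HLiu418 is explicitly the conjugate-space transport typed with the R6 identification binder —
conjugation is not assumed to preserve the variety or its cohomology algebra, so the barrier is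
respected, not evaded.
- Literature.Barriers.HodgeConjecture.Andre1996_hodgeClassesOnAbelianVarieties_motivated: the route
claims nothing about motivated cycles; the headline reaches HC_CM through theta lifting (Liu 2021),
and every crux is a printed theorem/definition instance, not a new statement about Hodge classes.
- Literature.Barriers.HodgeConjecture.AtiyahHirzebruch1962_torsionClass_notAlgebraic: not met —
HC_CM is the rational Hodge conjecture for CM abelian varieties; no integral/torsion class is
asserted algebraic.
- Literature.Barriers.HodgeConjecture.Kollar1992_nonTorsionClass_notAlgebraic: not met — same reason
(rational coefficients only; the integral counterexamples do not quantify over any crux).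
- Literature.Barriers.HodgeConjecture.Grothendieck1969_generalHodgeConjecture_false: not met — no
crux asserts the generalised (coniveau) Hodge conjecture; HC_CM is the classical statement for CM
abelian varieties.
- Negatives index: none of the seven statements or their negations is filed.

sub-problem: HodgeConjecture · status: draft · opened operator:999:102328 2026-08-28T02:27:11Z · rev 1 · ledger route-HodgeConjecture-HCCMUnconditional
GENERATED by the gate from the ledger (D-0016/17). Provers cite these decls: `theorem foo : Summit.HodgeConjecture.HodgeConjecture.Theses.HCCMUnconditional.<Decl> := …` in Summits/HodgeConjecture/HodgeConjecture/Theorems/<Name>.lean.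
-/

namespace Summit.HodgeConjecture.HodgeConjecture.Theses.HCCMUnconditional

open scoped BigOperators Topology Manifold Classical MeasureTheory ProbabilityTheory Matrix InnerProductSpace ComplexConjugate ContinuousMap
open Filter Set Function TopologicalSpace MeasureTheory

attribute [summit_statement] _root_.HodgeConjecture
attribute [summit_statement] _root_.Summit.HodgeConjecture.HodgeConjecture.Theses.RankFourFaces.CMAbelianHodge

/-- item stmt-HodgeConjecture-24832 · crux · rank 2 · open · by operator
why it might fail: The typed transport (conjugate space, R6 identification, universally quantified Φ′) may demand more than Thm 4.18 proves as printed; the ∀hDel closure could exceed what the headline consumes.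
sources: Liu2021
[crux] [Liu 2021, Thm 4.18] AS PRINTED for the conjugate hermitian space, transported back to the
printed datum — binder `hLiu418`, closed over HypDel because the printed statement is relative to
the canonical-model datum. Rung A-III; doubles as the H-R3 orientation check. [difficulty: L] -/
@[route_item "route-HodgeConjecture-HCCMUnconditional", crux]
def HLiu418 : Prop :=
  Summit.HodgeConjecture.CorCM.D2Bridge.MuKeyIdentLemD3DelRecConjOmegaEndT.PrintedCitationHypotheses.HypLiu418

/-- item stmt-HodgeConjecture-24833 · crux · rank 3 · open · by operator
why it might fail: Prop 4.13's hypotheses in print (local conditions at every place) may not match the tree's `prop413Data` pin; the dictionary pin `liuDictionaryPin …` fixes choices the paper leaves free.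
sources: Liu2021
[crux] [Liu 2021, Prop 4.13] AS PRINTED at the tree's uniform Ω-representation datum — binder
`h413`, closed over HypDel because the printed statement is relative to the canonical-model datum.
[difficulty: L] -/
@[route_item "route-HodgeConjecture-HCCMUnconditional", crux]
def H413 : Prop :=
  Summit.HodgeConjecture.CorCM.D2Bridge.MuKeyIdentLemD3DelRecConjOmegaEndT.PrintedCitationHypotheses.Hyp413

/-- item stmt-HodgeConjecture-24834 · crux · rank 4 · closed · proved by Summit.HodgeConjecture.HodgeConjecture.Theorems.H21_proof (prover) · by operator
why it might fail: The typed statement quantifies over all CM fields/infinity types admitted by the tree's `shimura1998_thm21_4_casselman`; the printed theorem carries a parity/conductor condition that must be checked to be encoded.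
sources: Shimura1998
[crux] [Shimura 1998, Thm 21.4] (Casselman): existence of algebraic Hecke characters of a CM field
with prescribed infinity type — binder `h21`, verbatim
(`Literature.NumberTheory.ComplexMultiplication.shimura1998_thm21_4_casselman`). [difficulty: L] -/
@[route_item "route-HodgeConjecture-HCCMUnconditional", crux]
def H21 : Prop :=
  Summit.HodgeConjecture.CorCM.D2Bridge.MuKeyIdentLemD3DelRecConjOmegaEndT.PrintedCitationHypotheses.Hyp21

-- `H21` holds: proved by `Summit.HodgeConjecture.HodgeConjecture.Theorems.H21_proof` (its module imports this route file, so no `_holds` link can be stated here).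

/-- item stmt-HodgeConjecture-24835 · crux · rank 5 · open · by operator
why it might fail: `canonicalModel_exists_printed` packages reciprocity at special points for the tree's unitary datum; Deligne's corollary is for Shimura data of abelian type and the reduction to it must be the printed one.
sources: Deligne1979ShimuraVarieties, Milne2005ShimuraVarieties
[crux] [Deligne 1979, 2.2.5 / Cor. 2.7.21]: the canonical model of the unitary Shimura datum exists
as printed — binder `hDel`, verbatim (`…UnitaryCanonicalModel.canonicalModel_exists_printed`).
[difficulty: L] -/
@[route_item "route-HodgeConjecture-HCCMUnconditional", crux]
def HDel : Prop :=
  Summit.HodgeConjecture.CorCM.D2Bridge.MuKeyIdentLemD3DelRecConjOmegaEndT.PrintedCitationHypotheses.HypDel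

/-- item stmt-HodgeConjecture-24836 · crux · rank 6 · closed · proved by Summit.HodgeConjecture.HodgeConjecture.Theorems.H411_proof (prover) · by operator
why it might fail: A definition 'as printed' is discharged by unfolding only if the tree's `Def411AsPrinted` is literally Liu's sentence; any extra normalisation (measures, ε-collections) makes it a genuine claim.
sources: Liu2021
[crux] [Liu 2021, Def 4.11] the defining sentence AS PRINTED at the tree's Thm-4.18 datum — binder
`h411`, closed over HypDel because the printed statement is relative to the canonical-model datum.
[difficulty: L] -/
@[route_item "route-HodgeConjecture-HCCMUnconditional", crux]
def H411 : Prop :=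
  Summit.HodgeConjecture.CorCM.D2Bridge.MuKeyIdentLemD3DelRecConjOmegaEndT.PrintedCitationHypotheses.Hyp411

-- `H411` holds: proved by `Summit.HodgeConjecture.HodgeConjecture.Theorems.H411_proof` (its module imports this route file, so no `_holds` link can be stated here).

/-- item stmt-HodgeConjecture-24837 · crux · rank 7 · closed · proved by Summit.HodgeConjecture.HodgeConjecture.Theorems.HD3_proof (prover) · by operator
why it might fail: Lem D.1(3) is stated for split/inert places under unramifiedness assumptions; the typed per-place family ranges over every height-one prime of F⁺, so ramified places may not be covered by print.
sources: Liu2021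
[crux] [Liu 2021, App. D Lem D.1(3)] AS PRINTED, per finite place, on the indexed family of the
tree's local data — binder `hD3`, closed over HypDel because the printed statement is relative to
the canonical-model datum. [difficulty: L] -/
@[route_item "route-HodgeConjecture-HCCMUnconditional", crux]
def HD3 : Prop :=
  Summit.HodgeConjecture.CorCM.D2Bridge.MuKeyIdentLemD3DelRecConjOmegaEndT.PrintedCitationHypotheses.HypD3

-- `HD3` holds: proved by `Summit.HodgeConjecture.HodgeConjecture.Theorems.HD3_proof` (its module imports this route file, so no `_holds` link can be stated here).

/-- item stmt-HodgeConjecture-24838 · crux · rank 8 · closed · proved by Summit.HodgeConjecture.HodgeConjecture.Theorems.HD1pp_proof (prover) · by operator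
why it might fail: Same per-place coverage risk as HD3; additionally the local splitting `chiLocalSplittingsD` is the tree's choice and Lem D.1(1) is printed for Liu's standard splitting.
sources: Liu2021
[crux] [Liu 2021, App. D Lem D.1(1)] AS PRINTED, per place, at the local data of 𝔯δ′⟦a, μ⟧ — binder
`hD1''`, closed over HypDel because the printed statement is relative to the canonical-model datum.
[difficulty: L] -/
@[route_item "route-HodgeConjecture-HCCMUnconditional", crux]
def HD1pp : Prop :=
  Summit.HodgeConjecture.CorCM.D2Bridge.MuKeyIdentLemD3DelRecConjOmegaEndT.PrintedCitationHypotheses.HypD1pp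

-- `HD1pp` holds: proved by `Summit.HodgeConjecture.HodgeConjecture.Theorems.HD1pp_proof` (its module imports this route file, so no `_holds` link can be stated here).

/-- item stmt-HodgeConjecture-27454 · support · rank 9 · open · by operator
why it might fail: Only in the letter: the tree's SiegelFineModuliScheme structure must say exactly what [MFK94] Thm. 7.9 gives (base Z[1/N], level N >= 3, the lettered polarisation type); a stronger field (properness, N < 3, base Z) is false as typed. F0P1-plan's REG ROW pins the comparison.
sources: Lan2013PELCompactifications, MumfordFogartyKirwan1994, MumfordAV1970, FaltingsChai1990
[support] FLOOR-0 socket (F) = binder hF of hc_cm_of_generic_floor_v7 (FloorV7 l. 69): the printed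
existence of the Siegel fine moduli scheme [Lan13, Thm. 1.4.1.11 + Cor. 7.2.3.9; MFK94 Thm. 7.9] as
the named fact lan2013_siegelFineModuliScheme. Programme P1: registry
Cruxes/HDel/Lines/F1ExtHodgeType.lean (letters stub_F3 dual abelian scheme, stub_F11 smooth lifting;
stub_II proved p796432), head Cruxes/HDel/Lines/F0_SiegelModuli.lean, threshold theorem p796022. -/
@[route_item "route-HodgeConjecture-HCCMUnconditional"]
def F0HF : Prop :=
  Summit.HodgeConjecture.HodgeConjecture.Theorems.F0FloorSockets.HFType

/-- item stmt-HodgeConjecture-27455 · support · rank 9 · open · by operator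
why it might fail: [GR91] is printed for U(2,1) over an imaginary quadratic field; the CM-field/level generality consumed is [Liu21]'s. The typed dictionary must give the theta lift with the exact archimedean type and ramified local components the H413 closing reads; a packet mismatch at a ramified place falsifies it.
sources: GelbartRogawski1991, Liu2021, Rogawski1992
[support] FLOOR-0 socket III-2 (a)' = binder hdictE (FloorV7 ll. 71-75): for every Deligne record
hDel, Galois CM field F with 6 <= [F:Q], signature-(2,1) hermitian 3-space V and pin (a0, Phi, i),
the oscillator-triple DICTIONARY EXISTS for the Prop. 4.13 datum over the tree's uniformOmegaRep
carriers ([GR91] Thm. 5.1.1, p. 446; [Liu21] proof of Prop. 4.13). Programme P2: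
Cruxes/H413/Lines/F0_P2CohSpectrumL2.lean, P2ThetaDictionaryExists.lean, P2a
F0_P2aCohIsotypicLine.lean / F0_P2aHodgeRealisation.lean. -/
@[route_item "route-HodgeConjecture-HCCMUnconditional", crux]
def F0HdictE : Prop :=
  Summit.HodgeConjecture.HodgeConjecture.Theorems.F0FloorSockets.HdictEType

/-- item stmt-HodgeConjecture-27456 · support · rank 9 · open · by operator
why it might fail: Multiplicity one for U(3) is Rogawski's theorem via the stabilised trace formula; on Mathlib it needs the inner-form trace identity T1 and the local packets. As typed it fails only if the printed datum lands on an endoscopic member where [Rog90] 13.3.1 gives no multiplicity one.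
sources: Rogawski1990, Rogawski1992, Liu2021, BlasiusRogawski1993
[support] FLOOR-0 socket III-J3a = binder hJ3a (FloorV7 ll. 76-80): multiplicity <= 1 of the Prop.
4.13 representation in the cohomological spectrum at the printed datum (multiplicity_le_one_printed;
[Rog90] Thm. 13.3.1, [Liu21] l. 2145). Programme P3 ENGINE:
Cruxes/H413/Lines/F0_T1InnerFormTraceIdentity.lean (T1 = inner-form trace identity, the calendar
item), F0_EngineLocalPackets.lean, F0_U3CohMultOne.lean. -/
@[route_item "route-HodgeConjecture-HCCMUnconditional", crux]
def F0HJ3a : Prop :=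
  Summit.HodgeConjecture.HodgeConjecture.Theorems.F0FloorSockets.HJ3aType

/-- item stmt-HodgeConjecture-27457 · support · rank 9 · open · by operator
why it might fail: Only in the typing: Li92 Thm 2.1 must be typed over the tree's carriers with the right Siegel-Weil constant and the pin's line transport untwisted (eta = 1); a normalisation slip falsifies it as typed.
sources: Liu2021, Li1992, GelbartRogawski1991, HarrisKudlaSweet1996, MoeglinVignerasWaldspurger1987, Weil1964
[support] FloorV7 socket hocc (ll. 81-85): for every Deligne record, Galois CM field F (6 <= [F:Q]),
signature-(2,1) hermitian 3-space V and pin (a0,Phi,i), the weight-one admissible packet occurs in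
H^1. Programme P4: Cruxes/H413/Lines/F0_P4AdmissibleOccursInH1.lean ED. 2, P4a
F0_P4aMatsushimaHodge.lean, E-2 Rallis inner product (rank-one slice). -/
@[route_item "route-HodgeConjecture-HCCMUnconditional"]
def F0Hocc : Prop :=
  Summit.HodgeConjecture.HodgeConjecture.Theorems.F0FloorSockets.HoccType

/-- item stmt-HodgeConjecture-27458 · support · rank 9 · open · by operator
why it might fail: [Liu21] 4.15's proof uses the congruence relation for the unitary Shimura curve over p-adic integral models (App. D Lem. D.1; RSZ, Kottwitz), absent from Mathlib (letter D.8); the face instantiation must match the pinned Hecke datum exactly (IsInducedBy): a pin mismatch is false as typed.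
sources: Liu2021, RapoportSmithlingZhang2017, Kottwitz1992, HarrisTaylor2001, Carayol1986
[support] FLOOR-0 socket III-9' = binder h415 : Thm415AtFace (FloorV7 l. 86; H415Type is its body
verbatim, Iff.rfl where both are imported): [Liu21] Thm. 4.15 (Thm415Pinned) at (C_V, U_V at a, nu,
A_nu, i_nu) for every induced etale Hecke datum X and every iota'. Programme P5:
Cruxes/HLiu418/Lines/F0_AlbCm.lean -> F0_AlbCmS1Betti.lean -> F0_AlbCmS1bHodge.lean;
F0_D9opRoad2.lean with letter D.8 RecordCurveCongruenceOnPoints (p-adic integral models, proposed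
programme P6). -/
@[route_item "route-HodgeConjecture-HCCMUnconditional", crux]
def F0H415 : Prop :=
  Summit.HodgeConjecture.HodgeConjecture.Theorems.F0FloorSockets.H415Type

/-- item stmt-HodgeConjecture-24839 · assembly · rank 1 · closed · proved by Summit.HodgeConjecture.HodgeConjecture.Theorems.Assembly_proof (prover) · by operator
sources: Liu2021, Deligne1979ShimuraVarieties, Shimura1998
[assembly] HC_CM from the 7 crux theorems via the existing headline:
`PrintedCitationHypotheses.hc_cm_of_hyps` (kernel certificate p588166) composed with `HC_CM =
RankFourFaces.CMAbelianHodge` (abbrev, CorCM/Interfaces.lean). -/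
@[route_item "route-HodgeConjecture-HCCMUnconditional"]
def Assembly : Prop :=
  HDel → H21 → HLiu418 → H413 → H411 → HD3 → HD1pp → Summit.HodgeConjecture.HodgeConjecture.Theses.RankFourFaces.CMAbelianHodge

-- `Assembly` holds: proved by `Summit.HodgeConjecture.HodgeConjecture.Theorems.Assembly_proof` (its module imports this route file, so no `_holds` link can be stated here).

/-! D-0027 §2.1 — DECIDING THEOREM (planner-authored via `route open/edit --closes-file`; by operator:999:102328 2026-08-28T02:27:11Z):
its hypotheses are this route's items and its conclusion the registered leaf `Summit.HodgeConjecture.HodgeConjecture.Theses.RankFourFaces.CMAbelianHodge` (rung HODGECM-MATHLIB-0, D-0061) (glue_lint), and it elaborates with this file. -/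

@[closes "route-HodgeConjecture-HCCMUnconditional"] theorem closes (hDel : HDel) (h21 : H21) (hLiu418 : HLiu418) (h413 : H413) (h411 : H411) (hD3 : HD3) (hD1pp : HD1pp) :
    Summit.HodgeConjecture.HodgeConjecture.Theses.RankFourFaces.CMAbelianHodge :=
  Summit.HodgeConjecture.CorCM.D2Bridge.MuKeyIdentLemD3DelRecConjOmegaEndT.PrintedCitationHypotheses.hc_cm_of_hyps hDel h21 hLiu418 h413 h411 hD3 hD1pp

end Summit.HodgeConjecture.HodgeConjecture.Theses.HCCMUnconditional
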